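import Mathlib

/-!
# Layer-chain Liouville / profile slaving — the 1D kernel beneath PS «ProfileSlaving» (decomp-a2c lens-3 g21, critic row 389 (3)(4)(ii))

In a door configuration EQUAL to a coherent layered state `LayeredHom L w`, force balance of the half-crystal above each
gap says that the stress transmitted across gap `m` is the same for every `m`:  `Φ m (p (m-1)) (p m) (p (m+1)) = σ`, where
`p m = w m - w (m-1)` is the profile increment (gap + registry + inner displacement) and `Φ m` is built from the interlayer
potentials (letter-dependent through the local stacking word, hence the index `m`).  TAG 138′ («optical positivity») says:
`Φ m a · c` is STRONGLY MONOTONE in the middle argument (interlayer breathing/shear stiffness `λ > 0`) and `κ`-Lipschitz in the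
outer arguments (second-layer couplings), with `2κ < λ` (21d numerics in the gap direction: λ ≥ 3.5, κ ≤ 0.99).

Abstract consequences PROVED here (real inner-product space `E`, index set `ℤ`, `Φ : ℤ → E → E → E → E`):
* `layerChain_stability`  — two bounded-difference profiles whose residuals differ by at most `ρ` everywhere differ by at most
  `ρ / (λ - 2κ)` everywhere (discrete maximum principle via `sSup`);
* `layerChain_unique`     — same transmitted stress ⇒ same profile (PS: the profile is SLAVED to (σ, word));
* `layerChain_const`      — letter-independent `Φ` (constant word: fcc, hcp) ⇒ every bounded solution is CONSTANT (1D Liouville),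
  by uniqueness applied to the shifted profile;
* `layerChain_periodic`   — `p`-periodic word ⇒ every bounded solution is `p`-periodic.
No LJ specifics: the constants are hypotheses (= TAG 138′).  Def-free; pure Mathlib.
-/

noncomputable section

open scoped RealInnerProductSpace

namespace Summit.AtomisticToContinuum.Crystallization.Theorems.ChartedPlanarOrderLayerChainLiouville

variable {E : Type*} [NormedAddCommGroup E] [InnerProductSpace ℝ E]

/-- **Stability (discrete maximum principle).** `Φ m` strongly monotone (`λ`) in the middle argument, `κ`-Lipschitz in the
outer ones, `2κ < λ`; two profiles `g g'` at bounded distance whose residuals differ by `≤ ρ` at every `m` are `ρ/(λ-2κ)`-close. -/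
theorem layerChain_stability (Φ : ℤ → E → E → E → E) {lam κ : ℝ} (hκ : 0 ≤ κ) (hdom : 2 * κ < lam)
    (hmono : ∀ m : ℤ, ∀ a b b' c : E, lam * ‖b - b'‖ ^ 2 ≤ ⟪Φ m a b c - Φ m a b' c, b - b'⟫)
    (hlip : ∀ m : ℤ, ∀ a a' b c c' : E, ‖Φ m a b c - Φ m a' b c'‖ ≤ κ * (‖a - a'‖ + ‖c - c'‖))
    (g g' : ℤ → E) {D : ℝ} (hD : ∀ m, ‖g m - g' m‖ ≤ D) {ρ : ℝ} (hρ : 0 ≤ ρ)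
    (hres : ∀ m, ‖Φ m (g (m - 1)) (g m) (g (m + 1)) - Φ m (g' (m - 1)) (g' m) (g' (m + 1))‖ ≤ ρ) :
    ∀ m, ‖g m - g' m‖ ≤ ρ / (lam - 2 * κ) := by
  have hlam : 0 < lam := by linarith
  have hgap : 0 < lam - 2 * κ := by linarith
  -- the supremum of the distances
  set S : Set ℝ := Set.range fun m : ℤ => ‖g m - g' m‖ with hS
  have hSne : S.Nonempty := ⟨‖g 0 - g' 0‖, ⟨0, rfl⟩⟩
  have hSbdd : BddAbove S := ⟨D, by rintro _ ⟨m, rfl⟩; exact hD m⟩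
  set Dst : ℝ := sSup S with hDst
  have hle : ∀ m, ‖g m - g' m‖ ≤ Dst := fun m => le_csSup hSbdd ⟨m, rfl⟩
  have hDst0 : 0 ≤ Dst := le_trans (norm_nonneg _) (hle 0)
  -- pointwise bootstrap: λ‖d m‖ ≤ ρ + 2κ·Dst
  have key : ∀ m, lam * ‖g m - g' m‖ ≤ ρ + 2 * κ * Dst := by
    intro m
    set d : E := g m - g' m with hd
    by_cases hd0 : d = 0
    · have : lam * ‖d‖ = 0 := by simp [hd0]
      nlinarith [mul_nonneg hκ hDst0]
    have hdpos : 0 < ‖d‖ := norm_pos_iff.mpr hd0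
    -- strong monotonicity in the middle argument, outer arguments frozen at g
    have h1 := hmono m (g (m - 1)) (g m) (g' m) (g (m + 1))
    -- split Φ(g_{m-1}, g_m, g_{m+1}) - Φ(g_{m-1}, g'_m, g_{m+1}) = [residual difference] + [outer-argument change]
    have hsplit : Φ m (g (m - 1)) (g m) (g (m + 1)) - Φ m (g (m - 1)) (g' m) (g (m + 1))
        = (Φ m (g (m - 1)) (g m) (g (m + 1)) - Φ m (g' (m - 1)) (g' m) (g' (m + 1)))
          + (Φ m (g' (m - 1)) (g' m) (g' (m + 1)) - Φ m (g (m - 1)) (g' m) (g (m + 1))) := by abel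
    have h2 : ⟪Φ m (g (m - 1)) (g m) (g (m + 1)) - Φ m (g (m - 1)) (g' m) (g (m + 1)), d⟫
        ≤ (ρ + κ * (‖g (m - 1) - g' (m - 1)‖ + ‖g (m + 1) - g' (m + 1)‖)) * ‖d‖ := by
      rw [hsplit, inner_add_left]
      have ha := real_inner_le_norm (Φ m (g (m - 1)) (g m) (g (m + 1)) - Φ m (g' (m - 1)) (g' m) (g' (m + 1))) d
      have hb := real_inner_le_norm (Φ m (g' (m - 1)) (g' m) (g' (m + 1)) - Φ m (g (m - 1)) (g' m) (g (m + 1))) d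
      have hb' : ‖Φ m (g' (m - 1)) (g' m) (g' (m + 1)) - Φ m (g (m - 1)) (g' m) (g (m + 1))‖
          ≤ κ * (‖g (m - 1) - g' (m - 1)‖ + ‖g (m + 1) - g' (m + 1)‖) := by
        have := hlip m (g' (m - 1)) (g (m - 1)) (g' m) (g' (m + 1)) (g (m + 1))
        rwa [norm_sub_rev (g' (m - 1)), norm_sub_rev (g' (m + 1))] at this
      have hres' := hres m
      nlinarith [norm_nonneg d, norm_nonneg (Φ m (g (m - 1)) (g m) (g (m + 1)) - Φ m (g' (m - 1)) (g' m) (g' (m + 1)))]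
    have h3 : κ * (‖g (m - 1) - g' (m - 1)‖ + ‖g (m + 1) - g' (m + 1)‖) ≤ 2 * κ * Dst := by
      have := hle (m - 1); have := hle (m + 1); nlinarith
    have h4 : lam * ‖d‖ ^ 2 ≤ (ρ + 2 * κ * Dst) * ‖d‖ := by
      calc lam * ‖d‖ ^ 2 ≤ ⟪Φ m (g (m - 1)) (g m) (g (m + 1)) - Φ m (g (m - 1)) (g' m) (g (m + 1)), d⟫ := h1
        _ ≤ (ρ + κ * (‖g (m - 1) - g' (m - 1)‖ + ‖g (m + 1) - g' (m + 1)‖)) * ‖d‖ := h2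
        _ ≤ (ρ + 2 * κ * Dst) * ‖d‖ := by
          exact mul_le_mul_of_nonneg_right (by linarith) (norm_nonneg d)
    -- divide by ‖d‖ > 0
    have : lam * ‖d‖ ≤ ρ + 2 * κ * Dst := by
      have h5 : lam * ‖d‖ * ‖d‖ ≤ (ρ + 2 * κ * Dst) * ‖d‖ := by rw [mul_assoc, ← sq]; exact h4
      exact le_of_mul_le_mul_right h5 hdpos
    exact this
  -- take the supremum: λ·Dst ≤ ρ + 2κ·Dst
  have hsup : lam * Dst ≤ ρ + 2 * κ * Dst := by
    have : Dst ≤ (ρ + 2 * κ * Dst) / lam := by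
      refine csSup_le hSne ?_
      rintro _ ⟨m, rfl⟩
      rw [le_div_iff₀ hlam, mul_comm]
      exact key m
    have := (le_div_iff₀ hlam).1 this
    linarith
  have hDst_le : Dst ≤ ρ / (lam - 2 * κ) := by
    rw [le_div_iff₀ hgap]; nlinarith
  exact fun m => (hle m).trans hDst_le

/-- **Uniqueness = profile slaving.** Same transmitted stress at every gap ⇒ the two bounded-distance profiles coincide. -/
theorem layerChain_unique (Φ : ℤ → E → E → E → E) {lam κ : ℝ} (hκ : 0 ≤ κ) (hdom : 2 * κ < lam)
    (hmono : ∀ m : ℤ, ∀ a b b' c : E, lam * ‖b - b'‖ ^ 2 ≤ ⟪Φ m a b c - Φ m a b' c, b - b'⟫)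
    (hlip : ∀ m : ℤ, ∀ a a' b c c' : E, ‖Φ m a b c - Φ m a' b c'‖ ≤ κ * (‖a - a'‖ + ‖c - c'‖))
    (g g' : ℤ → E) {D : ℝ} (hD : ∀ m, ‖g m - g' m‖ ≤ D)
    (heq : ∀ m, Φ m (g (m - 1)) (g m) (g (m + 1)) = Φ m (g' (m - 1)) (g' m) (g' (m + 1))) :
    g = g' := by
  funext m
  have h := layerChain_stability Φ hκ hdom hmono hlip g g' hD le_rfl
    (fun m => by rw [heq m, sub_self, norm_zero]) m
  rw [zero_div] at h
  exact sub_eq_zero.1 (norm_le_zero_iff.1 h)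

/-- **1D Liouville for a constant word.** If `Φ` does not depend on the layer index (fcc, hcp: one letter class), every BOUNDED
solution of `Φ (g (m-1)) (g m) (g (m+1)) = σ` is constant — uniqueness applied to the shifted profile `m ↦ g (m+1)`. -/
theorem layerChain_const (Φ₀ : E → E → E → E) {lam κ : ℝ} (hκ : 0 ≤ κ) (hdom : 2 * κ < lam)
    (hmono : ∀ a b b' c : E, lam * ‖b - b'‖ ^ 2 ≤ ⟪Φ₀ a b c - Φ₀ a b' c, b - b'⟫)
    (hlip : ∀ a a' b c c' : E, ‖Φ₀ a b c - Φ₀ a' b c'‖ ≤ κ * (‖a - a'‖ + ‖c - c'‖))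
    (g : ℤ → E) {B : ℝ} (hB : ∀ m, ‖g m‖ ≤ B) (σ : E)
    (heq : ∀ m, Φ₀ (g (m - 1)) (g m) (g (m + 1)) = σ) :
    ∀ m n, g m = g n := by
  -- g and its shift are two bounded solutions with the same stress
  have hshift : g = fun m => g (m + 1) := by
    refine layerChain_unique (fun _ => Φ₀) hκ hdom (fun _ => hmono) (fun _ => hlip) g (fun m => g (m + 1))
      (D := B + B) (fun m => (norm_sub_le _ _).trans (add_le_add (hB m) (hB (m + 1)))) ?_
    intro m
    show Φ₀ (g (m - 1)) (g m) (g (m + 1)) = Φ₀ (g (m - 1 + 1)) (g (m + 1)) (g (m + 1 + 1))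
    have h2 := heq (m + 1)
    simp only [sub_add_cancel, add_sub_cancel_right] at h2 ⊢
    rw [heq m]
    exact h2.symm
  -- hence g (m+1) = g m for all m, so g is constant on ℤ
  have hstep : ∀ m, g (m + 1) = g m := fun m => (congrFun hshift m).symm
  have hup : ∀ k : ℕ, ∀ m, g (m + k) = g m := by
    intro k; induction k with
    | zero => intro m; simp
    | succ k ih => intro m; rw [Nat.cast_succ, ← add_assoc, hstep, ih]
  intro m n
  rcases le_total m n with h | h
  · obtain ⟨k, rfl⟩ := Int.le.dest h
    exact (hup k m).symm
  · obtain ⟨k, rfl⟩ := Int.le.dest h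
    exact hup k n

/-- **Periodic word ⇒ periodic profile.** If the letter dependence of `Φ` is `p`-periodic, every bounded solution is `p`-periodic. -/
theorem layerChain_periodic (Φ : ℤ → E → E → E → E) (p : ℤ) (hper : ∀ m, Φ (m + p) = Φ m) {lam κ : ℝ} (hκ : 0 ≤ κ)
    (hdom : 2 * κ < lam)
    (hmono : ∀ m : ℤ, ∀ a b b' c : E, lam * ‖b - b'‖ ^ 2 ≤ ⟪Φ m a b c - Φ m a b' c, b - b'⟫)
    (hlip : ∀ m : ℤ, ∀ a a' b c c' : E, ‖Φ m a b c - Φ m a' b c'‖ ≤ κ * (‖a - a'‖ + ‖c - c'‖))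
    (g : ℤ → E) {B : ℝ} (hB : ∀ m, ‖g m‖ ≤ B) (σ : E)
    (heq : ∀ m, Φ m (g (m - 1)) (g m) (g (m + 1)) = σ) :
    ∀ m, g (m + p) = g m := by
  have hshift : g = fun m => g (m + p) := by
    refine layerChain_unique Φ hκ hdom hmono hlip g (fun m => g (m + p)) (D := B + B)
      (fun m => (norm_sub_le _ _).trans (add_le_add (hB m) (hB (m + p)))) ?_
    intro m
    show Φ m (g (m - 1)) (g m) (g (m + 1)) = Φ m (g (m - 1 + p)) (g (m + p)) (g (m + 1 + p))
    have h2 := heq (m + p)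
    rw [hper, show m + p - 1 = m - 1 + p by ring, show m + p + 1 = m + 1 + p by ring] at h2
    rw [heq m]
    exact h2.symm
  exact fun m => (congrFun hshift m).symm

/-- `|X| ≤ κ|t| ⇒ -(κ t²) ≤ X·t` (elementary). -/
private theorem mul_ge_neg_sq_of_abs_le {X t κ : ℝ} (hX : |X| ≤ κ * |t|) : -(κ * t ^ 2) ≤ X * t := by
  have h1 : -(|X| * |t|) ≤ X * t := by rw [← abs_mul]; exact neg_abs_le _
  have h2 : |X| * |t| ≤ κ * |t| * |t| := mul_le_mul_of_nonneg_right hX (abs_nonneg t)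
  have h3 : κ * |t| * |t| = κ * t ^ 2 := by rw [mul_assoc, abs_mul_abs_self, sq]
  linarith

/-- **Scalar instance (gap chain with symmetric second-layer coupling, constant word).** `f` = nearest-layer normal force
(slope `≥ λ₀`, TAG 138′ breathing stiffness), `h` = second-layer coupling (`κ`-Lipschitz), `4κ < λ₀`: every bounded solution of
`f (g m) + h (g (m-1) + g m) + h (g m + g (m+1)) = σ` on `ℤ` is constant. -/
theorem gapChain_const (f h : ℝ → ℝ) {lam0 κ : ℝ} (hκ : 0 ≤ κ) (hdom : 4 * κ < lam0)
    (hf : ∀ b b' : ℝ, lam0 * (b - b') ^ 2 ≤ (f b - f b') * (b - b'))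
    (hh : ∀ x y : ℝ, |h x - h y| ≤ κ * |x - y|)
    (g : ℤ → ℝ) {B : ℝ} (hB : ∀ m, |g m| ≤ B) (σ : ℝ)
    (heq : ∀ m, f (g m) + h (g (m - 1) + g m) + h (g m + g (m + 1)) = σ) :
    ∀ m n, g m = g n := by
  refine layerChain_const (E := ℝ) (fun a b c => f b + h (a + b) + h (b + c)) (lam := lam0 - 2 * κ) (κ := κ) hκ
    (by linarith) ?_ ?_ g (B := B) (fun m => by simpa [Real.norm_eq_abs] using hB m) σ heq
  · intro a b b' c
    simp only [RCLike.inner_apply, conj_trivial, Real.norm_eq_abs, sq_abs]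
    have h1 := hf b b'
    have h2 := hh (a + b) (a + b')
    have h3 := hh (b + c) (b' + c)
    rw [show a + b - (a + b') = b - b' by ring] at h2
    rw [show b + c - (b' + c) = b - b' by ring] at h3
    have e2 := mul_ge_neg_sq_of_abs_le h2
    have e3 := mul_ge_neg_sq_of_abs_le h3
    have : (f b + h (a + b) + h (b + c) - (f b' + h (a + b') + h (b' + c))) * (b - b')
        = (f b - f b') * (b - b') + (h (a + b) - h (a + b')) * (b - b') + (h (b + c) - h (b' + c)) * (b - b') := by ring
    rw [mul_comm (b - b') _, this]
    nlinarith [e2, e3, h1]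
  · intro a a' b c c'
    simp only [Real.norm_eq_abs]
    have h2 := hh (a + b) (a' + b)
    have h3 := hh (b + c) (b + c')
    rw [show a + b - (a' + b) = a - a' by ring] at h2
    rw [show b + c - (b + c') = c - c' by ring] at h3
    calc |f b + h (a + b) + h (b + c) - (f b + h (a' + b) + h (b + c'))|
        = |(h (a + b) - h (a' + b)) + (h (b + c) - h (b + c'))| := by ring_nf
      _ ≤ |h (a + b) - h (a' + b)| + |h (b + c) - h (b + c')| := abs_add_le _ _
      _ ≤ κ * |a - a'| + κ * |c - c'| := add_le_add h2 h3
      _ = κ * (|a - a'| + |c - c'|) := by ring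

end Summit.AtomisticToContinuum.Crystallization.Theorems.ChartedPlanarOrderLayerChainLiouville

end
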